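import Summits.Schanuel.Schanuel.Theorems.KhovanskiiApproxType.Negative.LoadBearing
import Summits.Schanuel.Schanuel.Theorems.DiophantineDichotomyKhovanskiiApproxTypeEvDefs
import Summits.Schanuel.Schanuel.Theorems.EPiSimultaneousType.Negative.CoordinatewiseLinear
import Literature.NumberTheory.Transcendental.LindemannWeierstrassProofs

/-!
# Negative lemma for crux `KhovanskiiApproxTypeEv` (stmt-Schanuel-14972): the exponent floor
# `a ≥ 1/2` on the NON-Lindemann–Weierstrass layer, kernel-checked at the log point
# `s = (log 2i, log(−2i)) = (λ, λ̄)`, `λ = log 2 + iπ/2`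

Companion of `Negative/ConjugateFloor.lean` (the LW point `(1 + i, 1 − i)`).  Here the conjugation
trick is run with the roles of the two slot families exchanged: the EXPONENTIALS are algebraic
(`e^{λ} = 2i`, `e^{λ̄} = −2i`, roots of `Y² + 4`) and the transcendental slots are the logarithms
`λ = log(2i)` (principal value, `= log 2 + iπ/2`, transcendental by Hermite–Lindemann — PROVED in tree,
`transcendental_exp_holds`) and `λ̄`.  `s = (λ, λ̄)` is `ℚ`-linearly independent (`Re λ = log 2 ≠ 0`,
`Im λ = π/2 ≠ 0`) and a non-degenerate zero of the Khovanskii system `y₁ + y₂ = 0`, `y₁ y₂ − 4 = 0`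
(exponential Jacobian `[[y₁, y₂], [y₁y₂, y₁y₂]]`, determinant `y₁y₂(y₁ − y₂) = 16 i`).  The challengers
`(α, ᾱ, 2i, −2i) ∈ ℚ(i, α, ᾱ)` with `α` the Diaz approximation of `λ` (Bugeaud 2004 Thm 8.11, PROVED in
tree) beat every `a < 1/2` past any threshold:

* `not_approxTypeEvAt_conjLogPair` — no eventual approximation type with `a < 1/2` at `(λ, λ̄)`;
* `evNonLWTwo_window` — so the line's OPEN non-LW layer `EvNonLWTwo` (claimed window `a < 1`), IF
  proved, has its exponent in `[1/2, 1)` at this point: the generic exponent `1/n` is attained on the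
  non-LW layer too, and an architecture for `EvNonLWTwo` capped below `1/2` is wrong.

With `Negative/ConjugateFloor.lean` this pins BOTH `n = 2` layers of the crux to the window `[1/2, 1)`.
Vocabulary as there (`ApproxTypeEvAt`, `EvNonLWTwo` from the line lead's EvDefs module).
-/

noncomputable section

set_option linter.dupNamespace false

namespace Summit.Schanuel.Schanuel.Cruxes.KhovanskiiApproxTypeEv.Negative

open Summit.Schanuel.Schanuel.Cruxes.KhovanskiiApproxType.LwSmallHeight
open Summit.Schanuel.Schanuel.Cruxes.KhovanskiiApproxType.Negative
open Summit.Schanuel.Schanuel.Cruxes.KhovanskiiApproxTypeEv.AnchoredReduction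
  (ApproxTypeEvAt EvNonLWTwo)
open Summit.Schanuel.Schanuel.Theorems.EPiSimultaneousType (finrank_adjoin_simple_le_of_clause)
open Polynomial Complex
open scoped IntermediateField ComplexConjugate
open Literature.NumberTheory.DiophantineApproximation (Bugeaud2004_thm_8_11_holds
  one_le_mahlerMeasure_map)
open Literature.NumberTheory.Transcendental (transcendental_exp_holds)

/-! ## The point `s = (λ, λ̄)`, `λ = log(2i)` -/

/-- `λ = log(2i)` (principal value `log 2 + iπ/2`). -/
def lam : ℂ := Complex.log (2 * I)

/-- `2i ≠ 0`. -/
theorem two_I_ne_zero : (2 : ℂ) * I ≠ 0 := mul_ne_zero two_ne_zero I_ne_zero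

/-- `e^{λ} = 2i`. -/
theorem exp_lam : Complex.exp lam = 2 * I := Complex.exp_log two_I_ne_zero

/-- `conj 2 = 2` in `ℂ`. -/
theorem conj_two : conj (2 : ℂ) = 2 := by apply Complex.ext <;> simp

/-- `conj (2i) = −2i`. -/
theorem conj_two_I : conj ((2 : ℂ) * I) = -(2 * I) := by apply Complex.ext <;> simp

/-- Simp-normal form: `simp` rewrites `cexp (conj λ)` to `conj (cexp λ)` first (`Complex.exp_conj`). -/
theorem conj_exp_lam : conj (Complex.exp lam) = -(2 * I) := by
  rw [exp_lam, conj_two_I]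

/-- `e^{λ̄} = −2i`. -/
theorem exp_conj_lam : Complex.exp (conj lam) = -(2 * I) := by
  rw [Complex.exp_conj, conj_exp_lam]

/-- `Re λ = log 2`. -/
theorem lam_re : lam.re = Real.log 2 := by
  rw [lam, Complex.log_re]
  congr 1
  simp

/-- `Re λ ≠ 0`. -/
theorem lam_re_ne : lam.re ≠ 0 := by
  rw [lam_re]; exact (Real.log_pos one_lt_two).ne'

/-- `Im λ = arg(2i) ≠ 0`. -/
theorem lam_im_ne : lam.im ≠ 0 := by
  rw [lam, Complex.log_im]
  intro h
  rw [Complex.arg_eq_zero_iff] at h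
  simp at h

/-- `λ ≠ 0`. -/
theorem lam_ne : lam ≠ 0 := fun h => lam_re_ne (by rw [h, Complex.zero_re])

/-- `(λ, λ̄)` is `ℚ`-linearly independent (`Re λ ≠ 0`, `Im λ ≠ 0`). -/
theorem linearIndependent_conjLogPair : LinearIndependent ℚ ![lam, conj lam] := by
  rw [LinearIndependent.pair_iff]
  intro s t hst
  rw [Rat.smul_def, Rat.smul_def] at hst
  have hre := congrArg Complex.re hst
  have him := congrArg Complex.im hst
  simp only [Complex.add_re, Complex.mul_re, Complex.ratCast_re, Complex.ratCast_im, zero_mul,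
    sub_zero, Complex.conj_re, Complex.zero_re, Complex.add_im, Complex.mul_im, Complex.conj_im,
    add_zero, Complex.zero_im] at hre him
  have h1 : ((s : ℝ) + t) * lam.re = 0 := by linarith
  have h2 : ((s : ℝ) - t) * lam.im = 0 := by linarith
  have h1' := (mul_eq_zero.mp h1).resolve_right lam_re_ne
  have h2' := (mul_eq_zero.mp h2).resolve_right lam_im_ne
  have hs : (s : ℝ) = 0 := by linarith
  have ht : (t : ℝ) = 0 := by linarith
  exact ⟨by exact_mod_cast hs, by exact_mod_cast ht⟩

/-- `λ = log(2i)` is transcendental (Hermite–Lindemann: `e^{λ} = 2i` is algebraic, `λ ≠ 0`). -/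
theorem transcendental_lam : Transcendental ℚ lam := by
  intro halg
  have h2I : IsAlgebraic ℚ ((2 : ℂ) * I) := by
    have hI : IsAlgebraic ℚ I := ⟨X ^ 2 + 1, by
      intro h; have := congrArg (fun Q : Polynomial ℚ => Q.coeff 0) h; simp at this, by simp⟩
    exact (isAlgebraic_nat 2).mul hI
  have ht := transcendental_exp_holds halg lam_ne
  rw [exp_lam] at ht
  exact ht h2I

/-- `(λ, λ̄)` is a non-degenerate zero of the Khovanskii system `y₁ + y₂ = 0`, `y₁ y₂ − 4 = 0` over
`ℚ` (`e^{λ} = 2i`, `e^{λ̄} = −2i`): exponential Jacobian `[[y₁, y₂], [y₁ y₂, y₁ y₂]]`, determinant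
`y₁ y₂ (y₁ − y₂) = 16 i ≠ 0`. -/
theorem isFreeKhovanskii_conjLogPair : IsFreeKhovanskii 2 ![lam, conj lam] := by
  classical
  refine ⟨![MvPolynomial.X (Sum.inr 0) + MvPolynomial.X (Sum.inr 1),
    MvPolynomial.X (Sum.inr 0) * MvPolynomial.X (Sum.inr 1) - MvPolynomial.C 4], ?_, ?_⟩
  · intro i
    fin_cases i
    · simp [exp_lam, conj_two]
    · simp [exp_lam, conj_two]
      ring_nf
      simp
  · rw [Matrix.det_fin_two]
    simp [Matrix.of_apply, MvPolynomial.pderiv_X, Derivation.leibniz, exp_lam, conj_two]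
    ring_nf
    simp [Complex.ext_iff]

/-- Evaluation of `Y² + 4` (minimal polynomial of `±2i`). -/
theorem aeval_sq_add_four (z : ℂ) :
    Polynomial.aeval z (X ^ 2 + Polynomial.C 4 : Polynomial ℤ) = z ^ 2 + 4 := by
  simp only [map_add, map_pow, Polynomial.aeval_X, map_ofNat]

/-- The coefficients of `Y² + 4` are bounded by `4` in absolute value. -/
theorem abs_coeff_sq_add_four_le (k : ℕ) :
    |(X ^ 2 + Polynomial.C 4 : Polynomial ℤ).coeff k| ≤ 4 := by
  rcases k with _ | _ | _ | k
  · norm_num [coeff_C, coeff_X_pow]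
  · norm_num [coeff_C, coeff_X_pow]
  · norm_num [coeff_C, coeff_X_pow]
  · have hk : k + 1 + 1 + 1 ≠ 2 := by omega
    simp [coeff_X_pow, hk]

/-- The coefficients of `X² + 1` are bounded by `1` in absolute value. -/
theorem abs_coeff_Xsq_add_one_le' (k : ℕ) :
    |(X ^ 2 + 1 : Polynomial ℤ).coeff k| ≤ 1 := by
  rcases k with _ | _ | _ | k
  · simp [coeff_one, coeff_X_pow]
  · simp [coeff_one, coeff_X_pow]
  · simp [coeff_one, coeff_X_pow]
  · have hk : k + 1 + 1 + 1 ≠ 2 := by omega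
    simp [coeff_one, coeff_X_pow, hk]

/-! ## The engine at the log point -/

set_option maxHeartbeats 1600000 in
/-- **At `θ = (λ, λ̄, 2i, −2i)`, `λ = log(2i)`, there is no eventual approximation type with
`a < 1/2`.**  Challengers `(α, ᾱ, 2i, −2i)`, `α` the Diaz approximation of `λ` of degree `≤ n`
(Bugeaud 2004 Thm 8.11, PROVED in tree), budget `d = 2n²` (field `ℚ(i, α, ᾱ)`), height
`H = max(H₀(d), 4, H(minpoly α))`; `|λ̄ − ᾱ| = |λ − α|`; quality `0.006(n log M(α) + deg α · log M)`
linear in `n ≍ d^{1/2}`. [cite: Bugeaud2004, Thm 8.11] -/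
theorem not_approxTypeEvAt_conjLogPair (a b C : ℝ) (ha : a < 1 / 2) :
    ¬ ApproxTypeEvAt 2 ![lam, conj lam] a b C := by
  rintro ⟨hC, hall⟩
  -- nonnegative exponents dominate
  set a' : ℝ := max a 0 with ha'
  set b' : ℝ := max b 0 with hb'
  have ha'h : a' < 1 / 2 := max_lt ha (by norm_num)
  have h2a' : 2 * a' < 1 := by linarith
  obtain ⟨n, hn50, hn⟩ := exists_deg (2 * a') (2 * C) h2a' (by linarith)
  have hn1nat : 1 ≤ n := le_trans (by norm_num) hn50
  have hn1 : (1 : ℝ) ≤ n := by exact_mod_cast hn1nat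
  have hnpos : (0 : ℝ) < n := by linarith
  -- the budget d = 2 n² and the bound C d^{a'} ≤ 0.003 n
  set d : ℕ := 2 * n ^ 2 with hddef
  have hdcast : (d : ℝ) = 2 * (n : ℝ) ^ 2 := by rw [hddef]; push_cast; ring
  have hnd : n ≤ d := by rw [hddef]; nlinarith
  have h2d : 2 ≤ d := by rw [hddef]; nlinarith
  have hd1 : (1 : ℝ) ≤ d := by exact_mod_cast (hn1nat.trans hnd)
  have hda' : C * (d : ℝ) ^ a' ≤ 3 / 1000 * n := by
    have h1 : (d : ℝ) ^ a' = (2 : ℝ) ^ a' * (n : ℝ) ^ (2 * a') := by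
      rw [hdcast, Real.mul_rpow (by norm_num) (by positivity)]
      congr 1
      rw [show ((n : ℝ) ^ 2) = (n : ℝ) ^ (2 : ℝ) by norm_cast, ← Real.rpow_mul hnpos.le]
    have h2 : (2 : ℝ) ^ a' ≤ 2 := by
      have := Real.rpow_le_rpow_of_exponent_le (by norm_num : (1 : ℝ) ≤ 2) (by linarith : a' ≤ 1)
      rwa [Real.rpow_one] at this
    have h3 : 0 ≤ (n : ℝ) ^ (2 * a') := by positivity
    calc C * (d : ℝ) ^ a' = C * ((2 : ℝ) ^ a' * (n : ℝ) ^ (2 * a')) := by rw [h1]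
      _ ≤ C * (2 * (n : ℝ) ^ (2 * a')) := by gcongr
      _ = 2 * C * (n : ℝ) ^ (2 * a') := by ring
      _ ≤ 3 / 1000 * n := hn
  -- the threshold of the eventual form at budget d
  obtain ⟨H₀, hH₀⟩ := hall d
  set H₁ : ℕ := max H₀ 4 with hH₁def
  have hH₁4nat : 4 ≤ H₁ := le_max_right _ _
  have hH₁1 : (1 : ℝ) ≤ H₁ := by exact_mod_cast le_trans (by norm_num) hH₁4nat
  have hH₁pos : (0 : ℝ) < H₁ := by linarith
  have hlogH₁ : 0 ≤ Real.log H₁ := Real.log_nonneg hH₁1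
  -- the M-independent slack (threshold included) and the choice of M
  set K0 : ℝ := C * ((d : ℝ) ^ a' * (n * Real.log 2 + Real.log H₁) + (d : ℝ) ^ b') with hK0
  set ξ : ℂ := lam with hξ
  set M : ℝ := max (max ((n : ℝ) + 1) ((4 + ‖ξ‖) ^ 100)) (Real.exp (K0 / (6 / 1000) + 1))
    with hMdef
  have hM1 : (n : ℝ) + 1 ≤ M := (le_max_left _ _).trans (le_max_left _ _)
  have hM2 : (4 + ‖ξ‖) ^ 100 ≤ M := (le_max_right _ _).trans (le_max_left _ _)
  have hMpos : 0 < M := by linarith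
  have hlogM : K0 / (6 / 1000) + 1 ≤ Real.log M := by
    rw [Real.le_log_iff_exp_le hMpos]
    exact le_max_right _ _
  -- Diaz / Bugeaud 8.11 at ξ = λ
  obtain ⟨α, P, hPirr, hPα, hPdeg, hPM, hdist⟩ := Bugeaud2004_thm_8_11_holds ξ n M hn50 hM1 hM2
  have hP0 : P ≠ 0 := hPirr.ne_zero
  have hdP : 1 ≤ P.natDegree := by
    rw [Nat.one_le_iff_ne_zero]
    intro h0
    have hc : P = Polynomial.C (P.coeff 0) := eq_C_of_natDegree_eq_zero h0
    rw [hc, aeval_C, algebraMap_int_eq, eq_intCast, Int.cast_eq_zero] at hPα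
    exact hP0 (by rw [hc, hPα, map_zero])
  set MP : ℝ := (P.map (Int.castRingHom ℂ)).mahlerMeasure with hMP
  have hMP1 : 1 ≤ MP := one_le_mahlerMeasure_map P hP0
  have hlogMP : 0 ≤ Real.log MP := Real.log_nonneg hMP1
  -- the conjugate root
  have hPα' : Polynomial.aeval (conj α) P = 0 := by
    have h := Polynomial.aeval_algHom_apply ((starRingEnd ℂ).toIntAlgHom) α P
    rw [RingHom.toIntAlgHom_apply] at h
    change Polynomial.aeval (conj α) P = conj (Polynomial.aeval α P) at h
    rw [h, hPα, map_zero]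
  -- the challenger γ = (α, conj α, 2i, −2i), budget d, height H := max H₁ (natHeight P) ≥ H₀
  set H : ℕ := max H₁ (natHeight P) with hHdef
  have hHP : natHeight P ≤ H := le_max_right _ _
  have hH0le : H₀ ≤ H := (le_max_left H₀ 4).trans (le_max_left _ _)
  have hH4 : 4 ≤ H := hH₁4nat.trans (le_max_left _ _)
  have hH1r : (1 : ℝ) ≤ H := by exact_mod_cast le_trans (by norm_num) hH4
  have hHpos : (0 : ℝ) < H := by linarith
  set γ : Fin 2 ⊕ Fin 2 → ℂ := Sum.elim ![α, conj α] ![(2 : ℂ) * I, -(2 * I)] with hγ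
  -- coordinatewise clauses at level (d, H)
  have hquad : ∀ z : ℂ, z = 2 * I ∨ z = -(2 * I) → ∃ Q : Polynomial ℤ, Q ≠ 0 ∧ Q.natDegree ≤ d ∧
      (∀ k, |Q.coeff k| ≤ (H : ℤ)) ∧ Polynomial.aeval z Q = 0 := by
    intro z hz
    have hQ0 : (X ^ 2 + Polynomial.C 4 : Polynomial ℤ) ≠ 0 := by
      intro h
      have := congrArg (fun Q : Polynomial ℤ => Q.coeff 0) h
      simp at this
    refine ⟨X ^ 2 + Polynomial.C 4, hQ0, ?_, ?_, ?_⟩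
    · have : (X ^ 2 + Polynomial.C 4 : Polynomial ℤ).natDegree ≤ 2 := by compute_degree!
      exact this.trans h2d
    · intro k
      have hH4z : (4 : ℤ) ≤ H := by exact_mod_cast hH4
      exact (abs_coeff_sq_add_four_le k).trans hH4z
    · have hI : I ^ 2 = -1 := Complex.I_sq
      rcases hz with rfl | rfl
      · rw [aeval_sq_add_four]; linear_combination (4 : ℂ) * hI
      · rw [aeval_sq_add_four]; linear_combination (4 : ℂ) * hI
  have hclα : ∀ z : ℂ, z = α ∨ z = conj α → ∃ Q : Polynomial ℤ, Q ≠ 0 ∧ Q.natDegree ≤ n ∧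
      (∀ k, |Q.coeff k| ≤ (H : ℤ)) ∧ Polynomial.aeval z Q = 0 := by
    intro z hz
    refine ⟨P, hP0, hPdeg, fun k => (abs_coeff_le_natHeight P k).trans (by exact_mod_cast hHP), ?_⟩
    rcases hz with rfl | rfl
    · exact hPα
    · exact hPα'
  have hcl : ∀ i, ∃ Q : Polynomial ℤ, Q ≠ 0 ∧ Q.natDegree ≤ d ∧ (∀ k, |Q.coeff k| ≤ (H : ℤ)) ∧
      Polynomial.aeval (γ i) Q = 0 := by
    rintro (i | i) <;> fin_cases i
    · obtain ⟨Q, h1, h2, h3, h4⟩ := hclα α (Or.inl rfl)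
      exact ⟨Q, h1, h2.trans hnd, h3, by simpa [hγ] using h4⟩
    · obtain ⟨Q, h1, h2, h3, h4⟩ := hclα (conj α) (Or.inr rfl)
      exact ⟨Q, h1, h2.trans hnd, h3, by simpa [hγ] using h4⟩
    · exact hquad _ (Or.inl (by simp [hγ]))
    · exact hquad _ (Or.inr (by simp [hγ]))
  -- the common field ℚ(i, α, conj α) has degree ≤ 2 n²
  have hfr : Module.finrank ℚ ↥(IntermediateField.adjoin ℚ (Set.range γ)) ≤ d := by
    have hIcl : ∃ Q : Polynomial ℤ, Q ≠ 0 ∧ Q.natDegree ≤ 2 ∧ (∀ k, |Q.coeff k| ≤ ((1 : ℕ) : ℤ)) ∧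
        Polynomial.aeval I Q = 0 := by
      refine ⟨X ^ 2 + 1, ?_, by compute_degree!, ?_, by simp⟩
      · intro h
        have := congrArg (fun Q : Polynomial ℤ => Q.coeff 0) h
        simp at this
      · intro k
        exact_mod_cast abs_coeff_Xsq_add_one_le' k
    obtain ⟨hiI, hI⟩ := finrank_adjoin_simple_le_of_clause hIcl
    obtain ⟨hiα, hα⟩ := finrank_adjoin_simple_le_of_clause (hclα α (Or.inl rfl))
    obtain ⟨hiα', hα'⟩ := finrank_adjoin_simple_le_of_clause (hclα (conj α) (Or.inr rfl))
    haveI : FiniteDimensional ℚ ↥ℚ⟮I⟯ := IntermediateField.adjoin.finiteDimensional hiI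
    haveI : FiniteDimensional ℚ ↥ℚ⟮α⟯ := IntermediateField.adjoin.finiteDimensional hiα
    haveI : FiniteDimensional ℚ ↥ℚ⟮conj α⟯ := IntermediateField.adjoin.finiteDimensional hiα'
    set F : IntermediateField ℚ ℂ := ℚ⟮I⟯ ⊔ (ℚ⟮α⟯ ⊔ ℚ⟮conj α⟯) with hF
    have hIF : I ∈ F := (le_sup_left : ℚ⟮I⟯ ≤ F) (IntermediateField.mem_adjoin_simple_self ℚ _)
    have h2IF : (2 : ℂ) * I ∈ F := mul_mem (by exact_mod_cast natCast_mem F 2) hIF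
    have hαF : α ∈ F :=
      (le_sup_left.trans (le_sup_right : ℚ⟮α⟯ ⊔ ℚ⟮conj α⟯ ≤ F)) (IntermediateField.mem_adjoin_simple_self ℚ _)
    have hα'F : conj α ∈ F :=
      (le_sup_right.trans (le_sup_right : ℚ⟮α⟯ ⊔ ℚ⟮conj α⟯ ≤ F)) (IntermediateField.mem_adjoin_simple_self ℚ _)
    have hle : IntermediateField.adjoin ℚ (Set.range γ) ≤ F := by
      rw [IntermediateField.adjoin_le_iff]
      rintro _ ⟨i, rfl⟩
      rcases i with i | i <;> fin_cases i
      · exact hαF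
      · exact hα'F
      · show (2 : ℂ) * I ∈ F
        exact h2IF
      · show -((2 : ℂ) * I) ∈ F
        exact neg_mem h2IF
    calc Module.finrank ℚ ↥(IntermediateField.adjoin ℚ (Set.range γ))
        ≤ Module.finrank ℚ ↥F := IntermediateField.finrank_le_of_le_right hle
      _ ≤ Module.finrank ℚ ↥ℚ⟮I⟯ * Module.finrank ℚ ↥(ℚ⟮α⟯ ⊔ ℚ⟮conj α⟯) :=
          IntermediateField.finrank_sup_le _ _
      _ ≤ Module.finrank ℚ ↥ℚ⟮I⟯ * (Module.finrank ℚ ↥ℚ⟮α⟯ * Module.finrank ℚ ↥ℚ⟮conj α⟯) :=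
          Nat.mul_le_mul_left _ (IntermediateField.finrank_sup_le _ _)
      _ ≤ 2 * (n * n) := Nat.mul_le_mul hI (Nat.mul_le_mul hα hα')
      _ = d := by rw [hddef]; ring
  have key := hH₀ H γ hH0le hfr hcl
  -- the distance is |λ - α| in both transcendental slots, 0 in the algebraic ones
  have hdist' : ‖γ - Sum.elim ![lam, conj lam] (Complex.exp ∘ ![lam, conj lam])‖ ≤ ‖ξ - α‖ := by
    refine (pi_norm_le_iff_of_nonneg (norm_nonneg _)).mpr ?_
    rintro (i | i) <;> revert i <;> refine Fin.forall_fin_two.mpr ⟨?_, ?_⟩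
    · simp [hγ, hξ, norm_sub_rev]
    · calc ‖(γ - Sum.elim ![lam, conj lam] (Complex.exp ∘ ![lam, conj lam])) (Sum.inl 1)‖
          = ‖conj α - conj ξ‖ := by simp [hγ, hξ]
        _ ≤ ‖ξ - α‖ := le_of_eq (by rw [← map_sub, Complex.norm_conj, norm_sub_rev])
    · simp [hγ, exp_lam]
    · simp [hγ, conj_exp_lam]
  -- height bookkeeping: log H ≤ log H₁ + n log 2 + log M(P)
  have hlogH : Real.log H ≤ Real.log H₁ + n * Real.log 2 + Real.log MP := by
    have h2n1 : (1 : ℝ) ≤ 2 ^ n * MP := one_le_mul_of_one_le_of_one_le (one_le_pow₀ (by norm_num)) hMP1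
    have hHle : (H : ℝ) ≤ (H₁ : ℝ) * (2 ^ n * MP) := by
      have hcast : (H : ℝ) = max (H₁ : ℝ) (natHeight P : ℝ) := by rw [hHdef]; push_cast; rfl
      rw [hcast]
      refine max_le (le_mul_of_one_le_right hH₁pos.le h2n1) ?_
      calc (natHeight P : ℝ) ≤ 2 ^ P.natDegree * MP := natHeight_le P
        _ ≤ 2 ^ n * MP := by gcongr; norm_num
        _ ≤ (H₁ : ℝ) * (2 ^ n * MP) := le_mul_of_one_le_left (by positivity) hH₁1
    calc Real.log H ≤ Real.log ((H₁ : ℝ) * (2 ^ n * MP)) := Real.log_le_log hHpos hHle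
      _ = Real.log H₁ + n * Real.log 2 + Real.log MP := by
        rw [Real.log_mul hH₁pos.ne' (by positivity), Real.log_mul (by positivity) (by positivity),
          Real.log_pow]
        ring
  -- exponent bookkeeping
  have hna : (d : ℝ) ^ a ≤ (d : ℝ) ^ a' := Real.rpow_le_rpow_of_exponent_le hd1 (le_max_left _ _)
  have hnb : (d : ℝ) ^ b ≤ (d : ℝ) ^ b' := Real.rpow_le_rpow_of_exponent_le hd1 (le_max_left _ _)
  have hlogH0 : 0 ≤ Real.log H := Real.log_nonneg hH1r
  have hda'0 : 0 ≤ (d : ℝ) ^ a' := by positivity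
  have hLHS : C * ((d : ℝ) ^ a * Real.log H + (d : ℝ) ^ b) ≤
      3 / 1000 * ((n : ℝ) * Real.log MP) + K0 := by
    have step : C * (d : ℝ) ^ a' * Real.log MP ≤ 3 / 1000 * n * Real.log MP :=
      mul_le_mul_of_nonneg_right hda' hlogMP
    calc C * ((d : ℝ) ^ a * Real.log H + (d : ℝ) ^ b)
        ≤ C * ((d : ℝ) ^ a' * Real.log H + (d : ℝ) ^ b') := by gcongr
      _ ≤ C * ((d : ℝ) ^ a' * (Real.log H₁ + n * Real.log 2 + Real.log MP) + (d : ℝ) ^ b') := by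
          gcongr
      _ = C * (d : ℝ) ^ a' * Real.log MP + K0 := by rw [hK0]; ring
      _ ≤ 3 / 1000 * n * Real.log MP + K0 := by linarith
      _ = 3 / 1000 * ((n : ℝ) * Real.log MP) + K0 := by ring
  have hKM : K0 < 6 / 1000 * Real.log M := by
    have h6 : (6 / 1000 : ℝ) * (K0 / (6 / 1000)) = K0 := by field_simp
    have h := mul_le_mul_of_nonneg_left hlogM (by norm_num : (0 : ℝ) ≤ 6 / 1000)
    rw [mul_add, h6] at h
    linarith
  have hX0 : 0 ≤ (n : ℝ) * Real.log MP := by positivity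
  have hlM : 0 ≤ Real.log M := by
    have hK0nn : 0 ≤ K0 := by rw [hK0]; positivity
    linarith
  have hY : Real.log M ≤ (P.natDegree : ℝ) * Real.log M :=
    le_mul_of_one_le_left hlM (by exact_mod_cast hdP)
  have hgap : C * ((d : ℝ) ^ a * Real.log H + (d : ℝ) ^ b) <
      6 / 1000 * ((n : ℝ) * Real.log MP + (P.natDegree : ℝ) * Real.log M) := by
    linarith
  -- contradiction
  have hchain : Real.exp (-(C * ((d : ℝ) ^ a * Real.log H + (d : ℝ) ^ b))) ≤
      Real.exp (-(6 / 1000 * ((n : ℝ) * Real.log MP + (P.natDegree : ℝ) * Real.log M))) :=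
    key.trans (hdist'.trans hdist)
  rw [Real.exp_le_exp] at hchain
  linarith

/-- **The non-LW layer's window is `[1/2, 1)` too:** IF `EvNonLWTwo` holds, its exponent at the log
point `(λ, λ̄)` (in scope: `λ` transcendental, `s` free Khovanskii and lin. independent) is `≥ 1/2`.
[folklore] -/
theorem evNonLWTwo_window (hN : EvNonLWTwo) :
    ∃ a b C : ℝ, 1 / 2 ≤ a ∧ a < 1 ∧ ApproxTypeEvAt 2 ![lam, conj lam] a b C := by
  obtain ⟨a, b, C, ha, hAT⟩ := hN _ linearIndependent_conjLogPair isFreeKhovanskii_conjLogPair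
    ⟨0, by simpa using transcendental_lam⟩
  refine ⟨a, b, C, ?_, ha, hAT⟩
  by_contra hlt
  exact not_approxTypeEvAt_conjLogPair a b C (not_le.mp hlt) hAT

end Summit.Schanuel.Schanuel.Cruxes.KhovanskiiApproxTypeEv.Negative

end
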